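import Mathlib
import Summits.ResolutionOfSingularities.ResolutionOfSingularities.Theorems.RadicialJungCleanModelsCleanProp44LocalizationTransport
import HarnessLib

/-!
# Route `RadicialJung`, crux `CleanModels` (stmt-ResolutionOfSingularities-15917), line `Sketch` rev 35, stub 6 `stub_cleanProp44` (X44c):
# THE CHART IDENTIFICATION (census (S2)) AT THE GENERIC POINT OF THE NEAR CURVE — STEP 1 of the `δ`-descent from «`𝒪_{E,η″}` is a localization of
# `κ(c)[u][T]` at SOME submonoid» + «non-zero polynomials in `u` are units» + «the face lies in `𝔫^μ`»

Seat decomp-res-hand-2 g22 (structural hand); composition of ✓ `exists_prime_comap_maximalIdeal_eq_span` (p838494) with ✓ `exists_successor_of_isLocalization`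
(p838418).  Along the σ-tower read at the GENERIC points `η_{Z_j}` the stalks `D_j = κ(Z_{j−1})` are fields, so every non-zero `g(u)` acts as a unit on
`𝒪_{E,η″}` (`isUnit_algebraMap_of_forall_isUnit`: a localization map out of the domain `κ[u]` into a ring whose non-zero elements are units sends `g ≠ 0`
to a unit); the face `Φ` (✓ `tower_face`: `deg_T Φ ≤ μ`, top coefficient the non-zero constant `c`) lies in `𝔫^μ` at a near point ((S3), ✓
`map_mem_maximalIdeal_pow_of_surjective`), hence `𝔫 ∩ κ[u][T] ∋ Φ ≠ 0`.  Therefore: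

* `comap_maximalIdeal_ne_bot_of_face` — `𝔫 ∩ κ[u][T] ≠ 0`.
* `exists_successor_at_genericPoint` — **STEP 1 from the transported invariant alone**: `𝔫 ∩ κ[u][T] = (π)`, `π = a(T + λ)` prime, `Φ = c(T + λ)^μ`,
  `deg λ ≤ δ`, `deg λ′ ≤ δ − 2` — the successor line `Γ″ = V(T + λ)` and the input of ✓ `birth_descent_of_isLocalization` / ✓ `descent_le_sub_two`.

Honest framing: OURS, composition; nothing here proves X44c, any case of `CleanModels`, or resolution of singularities in characteristic `p`.
[cite: CossartPiltant2008, Lemma 4.3 (5); Prop. 4.4 (proof, p. 11)] [cite: Matsumura1987, Thm. 4.1–4.3]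
-/

noncomputable section

set_option linter.dupNamespace false -- mandated namespace of this single-conjunct summit

open Polynomial IsLocalRing

namespace Summit.ResolutionOfSingularities.ResolutionOfSingularities.Theorems.RadicialJung.CleanModels

section GenericPoint

variable {k : Type*} [Field k]

/-- A localization map out of a domain into a non-trivial ring all of whose non-zero elements are units sends non-zero elements to units (the σ-curve stalks
at generic points are the FIELDS `κ(Z_j)`, localizations of `κ(c)[u]`). [folklore] -/
theorem isUnit_algebraMap_of_forall_isUnit {A D : Type*} [CommRing A] [IsDomain A] [CommRing D] [Nontrivial D] [Algebra A D] (N : Submonoid A)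
    [IsLocalization N D] (hD : ∀ d : D, d ≠ 0 → IsUnit d) {g : A} (hg : g ≠ 0) : IsUnit (algebraMap A D g) := by
  refine hD _ fun h0 => ?_
  obtain ⟨⟨m, hm⟩, hmg⟩ := (IsLocalization.map_eq_zero_iff N D g).mp h0
  have hm0 : m = 0 := by
    rcases mul_eq_zero.mp hmg with h | h
    · exact h
    · exact absurd h hg
  subst hm0
  -- `0 ∈ N` forces `D` trivial
  have h1 : IsUnit (algebraMap A D 0) := IsLocalization.map_units D ⟨0, hm⟩
  rw [map_zero] at h1
  exact not_isUnit_zero h1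

variable {S : Type*} [CommRing S] [Algebra (k[X])[X] S] [IsLocalRing S]

/-- **`𝔫 ∩ κ[u][T] ≠ 0` at a near point**: the face `Φ` (top coefficient `C c`, `c ≠ 0`) lies in `𝔫^μ ⊆ 𝔫` (`μ ≥ 1`), and `Φ ≠ 0`. [folklore] -/
theorem comap_maximalIdeal_ne_bot_of_face {Φ : (k[X])[X]} {μ : ℕ} (hμ : 1 ≤ μ) {c : k} (hc : c ≠ 0) (htop : Φ.coeff μ = C c)
    (hΦ : algebraMap (k[X])[X] S Φ ∈ maximalIdeal S ^ μ) : (maximalIdeal S).comap (algebraMap (k[X])[X] S) ≠ ⊥ := by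
  intro h
  have hΦ0 : Φ ≠ 0 := by
    intro h0
    rw [h0, coeff_zero] at htop
    exact hc (C_injective (by rw [← htop, C_0]))
  have hmem : Φ ∈ (maximalIdeal S).comap (algebraMap (k[X])[X] S) := by
    rw [Ideal.mem_comap]
    exact Ideal.pow_le_self (by omega) hΦ
  rw [h, Ideal.mem_bot] at hmem
  exact hΦ0 hmem

/-- **STEP 1 of the `δ`-descent from the transported invariant alone** (see the module docstring). [cite: CossartPiltant2008, Lemma 4.3 (5); Prop. 4.4 (proof, p. 11)] -/
theorem exists_successor_at_genericPoint (M : Submonoid (k[X])[X]) [IsLocalization M S]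
    (hC : ∀ g : k[X], g ≠ 0 → IsUnit (algebraMap (k[X])[X] S (C g)))
    {Φ : (k[X])[X]} {μ δ : ℕ} (hμ : 1 ≤ μ) (hdeg : Φ.natDegree ≤ μ) {c : k} (hc : c ≠ 0) (htop : Φ.coeff μ = C c)
    (hC0 : (Φ.coeff 0).natDegree ≤ μ * δ) (hδ : (δ : k) = 0) (hΦ : algebraMap (k[X])[X] S Φ ∈ maximalIdeal S ^ μ) :
    ∃ (π : (k[X])[X]) (a : k) (lam : k[X]), Prime π ∧ (maximalIdeal S).comap (algebraMap (k[X])[X] S) = Ideal.span {π} ∧ a ≠ 0 ∧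
      π = C (C a) * (X + C lam) ∧ Φ = C (C c) * (X + C lam) ^ μ ∧ lam.natDegree ≤ δ ∧ (derivative lam).natDegree ≤ δ - 2 := by
  obtain ⟨π, hπ, h𝔮⟩ := exists_prime_comap_maximalIdeal_eq_span hC (comap_maximalIdeal_ne_bot_of_face hμ hc htop hΦ)
  haveI : (Ideal.span {π}).IsPrime := (Ideal.span_singleton_prime hπ.ne_zero).mpr hπ
  haveI : IsLocalization.AtPrime S (Ideal.span {π}) := by
    refine IsLocalization.of_le M _ (fun m hm => ?_) (fun r hr => ?_)
    · intro hm'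
      have : m ∈ (maximalIdeal S).comap (algebraMap (k[X])[X] S) := by rw [h𝔮]; exact hm'
      rw [Ideal.mem_comap] at this
      exact (IsLocalRing.mem_maximalIdeal _).mp this (IsLocalization.map_units S ⟨m, hm⟩)
    · by_contra hu
      apply hr
      have : r ∈ (maximalIdeal S).comap (algebraMap (k[X])[X] S) := by
        rw [Ideal.mem_comap]; exact (IsLocalRing.mem_maximalIdeal _).mpr hu
      rw [h𝔮] at this
      exact this
  obtain ⟨a, lam, ha, hπeq, hΦeq, hlam, hlam'⟩ := exists_successor_of_isLocalization hμ hdeg hc htop hC0 hδ hπ S hΦ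
  exact ⟨π, a, lam, hπ, h𝔮, ha, hπeq, hΦeq, hlam, hlam'⟩

end GenericPoint

end Summit.ResolutionOfSingularities.ResolutionOfSingularities.Theorems.RadicialJung.CleanModels

end
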